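import Summits.ResolutionOfSingularities.ResolutionOfSingularities.Theorems.PurelyInseparableDim4UnitClassVertex
import Summits.ResolutionOfSingularities.ResolutionOfSingularities.Theorems.PurelyInseparableDim4ShadeTwoSwapRead
import HarnessLib
import HarnessLib.Audit.Tags

/-!
# Purely inseparable four-folds — the POLAR KERNEL THROUGH A ONE-FREE-LETTER RE-PRESENTATION: `resVertex B` is the
# pull-back of `resVertex A` under the 1-jet, so a kernel-determined translation on `A` READS a unique translation on `B`
# satisfying the 1-jet relation of SN3 (cell `res-dim4-pi`, K2(p) lane, slice C; light-lossy class = hN4-C, FILE 2 of 4)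

[OURS · counted 0 · cell `res-dim4-pi` · K2(p) lane (holder res-dim4-p-12 g4; route of record «LIGHT-LOSSY = C13 ∘
RE-PRESENTATION (hN4-C)», res-dim4-idea-1 g7) · seat res-dim4-p-1 g5.]  Nothing here proves K2(5)
(`RidgeBudget.NoAboveFloorTrap 5 5`), `NoIsolatedTrap 5 5` or resolution of singularities in dimension ≥ 4 / characteristic
`p` — NOT proved.  AI kernel work, weaker than expert review.

Setting: the unit-class relation `ℛ_π(A.F, B.F)` of res-dim4-p-7 g3's `…SwapRelation` with ONE free letter `f`
(`θ (π i) = x_i · e_i` for `i ≠ f`, `θ (π f) = x_f · e_f + G`, `e_i(0) ≠ 0`, `G(0) = 0`, `∂_f G(0) = 0`,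
`B.F = clean(U^p · θ(A.F)) + E`, `E ∈ 𝔪₀ᴹ`), in the band `p ∤ ord₀ A.F < M`, `x^{r_A} ∣ A.F`, `A.r (π f) = 0`, `B.r = A.r ∘ π`.
* §1 **`resVertex_eq_comap`** — `resVertex B = (resVertex A).comap N` for the 1-jet matrix `N k i = ∂_i θ_k (0)` (res-dim4-p-7
  g4's `SwapNorm.resForm_of_slotUnit_rel` and `SwapNorm.additiveSubspace_aeval_linSubst`, read with `u := f`: the one-free-letter
  class is the two-free-letter class with both free letters equal); `finrank_resVertex_eq` (= p-7's
  `finrank_resVertex_eq_of_slotUnit_rel`, same reading): `e_G` passes through.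
* §2 `mulVec_single_add` — the 1-jet on the line `e_ℓ + K·e_f` (`ℓ ≠ f`): `N (e_ℓ + γ′ e_f) = e_ℓ(0)·e_{πℓ} +
  (∂_ℓ G(0) + γ′ e_f(0))·e_{πf}`.
* §3 **`exists_translation_mem_resVertex`** / **`jet_relation_of_mem_resVertex`** — if `e_{πℓ} + γ·e_{πf} ∈ resVertex A`
  then some `e_ℓ + γ′·e_f ∈ resVertex B`; and if the kernel of `A` meets the line `e_{πℓ} + K·e_{πf}` in ONE point (the light
  class: FILE 1 `ResCone.translation_unique_of_light`), then EVERY such `γ′` satisfies res-dim4-p-11 g3's 1-jet relation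
  `γ · e_ℓ(0) = ∂_ℓ G(0) + γ′ · e_f(0)` of `SwapTransport.unitFrame_step` — the virtual translation is READ OFF `resVertex B`,
  independently of the relation chosen.
[cite: CossartJannsenSaito2020, Def. 2.18, Thm. 3.14] [cite: Hauser2010, §§F–G] bears_on: LADDER-RESOLUTION:D157-DOOR2
(res-dim4-pi · K2(p) · slice C · light-lossy (5,3) = hN4-C · FILE 2).  Supports stmt-ResolutionOfSingularities-16155 (helper).
-/

set_option linter.dupNamespace false -- mandated namespace of this single-conjunct summit

noncomputable section

namespace Summit.ResolutionOfSingularities.ResolutionOfSingularities.Theorems.PIDim4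

namespace ResCone

namespace LightRep

open MvPolynomial Finset
open Literature.AlgebraicGeometry.Resolution
open Literature.AlgebraicGeometry.Resolution.CentreBlowup
open Literature.AlgebraicGeometry.Resolution.Hauser2010
open Literature.AlgebraicGeometry.Resolution.HauserPerlega2019
open PointBlowup (polarMap additiveSubspace direction)

variable {K : Type} [Field K]

/-! ## 1. The kernel is the pull-back of the kernel -/

section Rel

variable (p : ℕ)
variable {π : Equiv.Perm (Fin 4)} {f : Fin 4} {θ e : Fin 4 → MvPolynomial (Fin 4) K} {G U E : MvPolynomial (Fin 4) K}
  {A B : State K} {M o : ℕ}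

/-- **`resVertex B = N⁻¹(resVertex A)`** through a one-free-letter unit-class relation in the band, `N` the 1-jet of `θ`.
[OURS · dress of res-dim4-p-7 g4's `resForm_of_slotUnit_rel` + `additiveSubspace_aeval_linSubst` with `u := f`]
[cite: CossartJannsenSaito2020, Def. 2.18] -/
theorem resVertex_eq_comap (hθi : ∀ i, i ≠ f → θ (π i) = X i * e i) (hθf : θ (π f) = X f * e f + G)
    (he : ∀ i, constantCoeff (e i) ≠ 0) (hG0 : constantCoeff G = 0) (hG1 : coeff (Finsupp.single f 1) G = 0)
    (hU : constantCoeff U ≠ 0) (hE : E ∈ originIdeal K ^ M) (hrel : B.F = deletePthPowers p (U ^ p * aeval θ A.F) + E)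
    (ho : ordZero A.F = o) (hpo : ¬ p ∣ o) (hoM : o < M) (hrA : ∀ d ∈ A.F.support, A.r ≤ d) (hrf : A.r (π f) = 0)
    (hrB : B.r = A.r.mapDomain π.symm) :
    resVertex B = (resVertex A).comap
      (Matrix.toLin' (Matrix.of fun k i => coeff (Finsupp.single i 1) (θ k))) := by
  classical
  have hθ0 : ∀ k, constantCoeff (θ k) = 0 := SwapNorm.unitClass_origin hθi hθf hG0
  have hdet := SwapNorm.isUnit_det_unitClass hθi hθf he hG1
  set N : Matrix (Fin 4) (Fin 4) K := Matrix.of fun k i => coeff (Finsupp.single i 1) (θ k) with hN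
  have hJN : (fun k => ∑ l, C (coeff (Finsupp.single l 1) (θ k)) * X l) =
      (fun k => ∑ l, C (N k l) * X l : Fin 4 → MvPolynomial (Fin 4) K) := by
    funext k; rfl
  have hin0 : initialForm A.F ≠ 0 := by
    intro h0
    have h1 := Directrix.initialForm_eq_homogeneousComponent ho
    rw [h0] at h1
    obtain ⟨⟨d, hd, hdeg⟩, -⟩ := (ordZero_eq_nat_iff _ _).mp ho
    have h2 : coeff d (homogeneousComponent o A.F) = coeff d A.F := by rw [coeff_homogeneousComponent, if_pos hdeg]
    rw [← h1, coeff_zero] at h2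
    exact hd h2.symm
  have hJ0 : aeval (fun k => ∑ l, C (coeff (Finsupp.single l 1) (θ k)) * X l) (initialForm A.F) ≠ 0 := by
    rw [hJN, ← map_zero (aeval (fun k => ∑ l, C (N k l) * X l) : MvPolynomial (Fin 4) K →ₐ[K] MvPolynomial (Fin 4) K)]
    exact fun h => hin0 (SwapNorm.aeval_linSubst_injective hdet h)
  obtain ⟨c, hc, hres⟩ := SwapNorm.resForm_of_slotUnit_rel p (u := f) (fun i _ hif => hθi i hif)
    (fun i _ _ => he i) hθ0 hU hE hrel ho hpo hoM hJ0 hrA hrf hrf hrB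
  unfold ResCone.resVertex
  rw [hres, SwapNorm.additiveSubspace_C_mul hc, hJN, SwapNorm.additiveSubspace_aeval_linSubst hdet]

/-- **`e_G` passes through the relation** (res-dim4-p-7 g4's `finrank_resVertex_eq_of_slotUnit_rel`, read with `u := f`).
[OURS · bookkeeping] [cite: CossartJannsenSaito2020, Def. 2.18] -/
theorem finrank_resVertex_eq (hθi : ∀ i, i ≠ f → θ (π i) = X i * e i) (hθf : θ (π f) = X f * e f + G)
    (he : ∀ i, constantCoeff (e i) ≠ 0) (hG0 : constantCoeff G = 0) (hG1 : coeff (Finsupp.single f 1) G = 0)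
    (hU : constantCoeff U ≠ 0) (hE : E ∈ originIdeal K ^ M) (hrel : B.F = deletePthPowers p (U ^ p * aeval θ A.F) + E)
    (ho : ordZero A.F = o) (hpo : ¬ p ∣ o) (hoM : o < M) (hrA : ∀ d ∈ A.F.support, A.r ≤ d) (hrf : A.r (π f) = 0)
    (hrB : B.r = A.r.mapDomain π.symm) :
    Module.finrank K (resVertex B) = Module.finrank K (resVertex A) :=
  SwapNorm.finrank_resVertex_eq_of_slotUnit_rel p (u := f) (fun i _ hif => hθi i hif) (fun i _ _ => he i)
    (SwapNorm.unitClass_origin hθi hθf hG0) (SwapNorm.isUnit_det_unitClass hθi hθf he hG1) hU hE hrel ho hpo hoM hrA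
    hrf hrf hrB

end Rel

/-! ## 2. The 1-jet on the line `e_ℓ + K·e_f` -/

section Jet

variable {π : Equiv.Perm (Fin 4)} {f : Fin 4} {θ e : Fin 4 → MvPolynomial (Fin 4) K} {G : MvPolynomial (Fin 4) K}

/-- `N (e_ℓ + γ′ e_f) = e_ℓ(0)·e_{πℓ} + (∂_ℓ G(0) + γ′ e_f(0))·e_{πf}` for the 1-jet `N` of a one-free-letter unit-class `θ`.
[folklore] -/
theorem mulVec_single_add (hθi : ∀ i, i ≠ f → θ (π i) = X i * e i) (hθf : θ (π f) = X f * e f + G)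
    (hG1 : coeff (Finsupp.single f 1) G = 0) {ℓ : Fin 4} (hℓf : ℓ ≠ f) (γ' : K) :
    Matrix.mulVec (Matrix.of fun k i => coeff (Finsupp.single i 1) (θ k))
        ((Pi.single ℓ 1 : Fin 4 → K) + γ' • (Pi.single f 1 : Fin 4 → K)) =
      constantCoeff (e ℓ) • (Pi.single (π ℓ) 1 : Fin 4 → K) +
        (coeff (Finsupp.single ℓ 1) G + γ' * constantCoeff (e f)) • (Pi.single (π f) 1 : Fin 4 → K) := by
  classical
  funext k
  simp only [Matrix.mulVec, dotProduct_add, dotProduct_smul, dotProduct_single, mul_one, Matrix.of_apply, Pi.add_apply,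
    Pi.smul_apply, smul_eq_mul, Pi.single_apply]
  obtain ⟨i, rfl⟩ := π.surjective k
  have hinj : ∀ a : Fin 4, (π i = π a ↔ i = a) := fun a => π.injective.eq_iff
  simp only [hinj]
  by_cases hif : i = f
  · subst hif
    rw [if_neg (Ne.symm hℓf), if_pos rfl, hθf, coeff_add, coeff_add, SwapNorm.coeff_single_X_mul_eq,
      SwapNorm.coeff_single_X_mul_eq, if_neg hℓf, if_pos rfl, hG1]
    ring
  · rw [if_neg hif, hθi i hif, SwapNorm.coeff_single_X_mul_eq, SwapNorm.coeff_single_X_mul_eq, if_neg (Ne.symm hif) ]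
    by_cases hiℓ : i = ℓ
    · subst hiℓ; rw [if_pos rfl, if_pos rfl]; ring
    · rw [if_neg (Ne.symm hiℓ), if_neg hiℓ]; ring

end Jet

/-! ## 3. Reading the translation off `resVertex B` -/

section Read

variable (p : ℕ)
variable {π : Equiv.Perm (Fin 4)} {f : Fin 4} {θ e : Fin 4 → MvPolynomial (Fin 4) K} {G U E : MvPolynomial (Fin 4) K}
  {A B : State K} {M o : ℕ}

/-- **A real kernel direction has a virtual partner on the same line**: if `e_{πℓ} + γ·e_{πf} ∈ resVertex A` then
`e_ℓ + γ′·e_f ∈ resVertex B` for `γ′ = (γ e_ℓ(0) − ∂_ℓ G(0)) / e_f(0)`. [OURS] [cite: CossartJannsenSaito2020, Thm. 3.14] -/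
theorem exists_translation_mem_resVertex (hθi : ∀ i, i ≠ f → θ (π i) = X i * e i)
    (hθf : θ (π f) = X f * e f + G) (he : ∀ i, constantCoeff (e i) ≠ 0) (hG0 : constantCoeff G = 0)
    (hG1 : coeff (Finsupp.single f 1) G = 0) (hU : constantCoeff U ≠ 0) (hE : E ∈ originIdeal K ^ M)
    (hrel : B.F = deletePthPowers p (U ^ p * aeval θ A.F) + E) (ho : ordZero A.F = o) (hpo : ¬ p ∣ o) (hoM : o < M)
    (hrA : ∀ d ∈ A.F.support, A.r ≤ d) (hrf : A.r (π f) = 0) (hrB : B.r = A.r.mapDomain π.symm)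
    {ℓ : Fin 4} (hℓf : ℓ ≠ f) {γ : K}
    (hγA : (Pi.single (π ℓ) 1 : Fin 4 → K) + γ • (Pi.single (π f) 1 : Fin 4 → K) ∈ resVertex A) :
    ∃ γ' : K, (Pi.single ℓ 1 : Fin 4 → K) + γ' • (Pi.single f 1 : Fin 4 → K) ∈ resVertex B := by
  refine ⟨(γ * constantCoeff (e ℓ) - coeff (Finsupp.single ℓ 1) G) / constantCoeff (e f), ?_⟩
  rw [resVertex_eq_comap p hθi hθf he hG0 hG1 hU hE hrel ho hpo hoM hrA hrf hrB, Submodule.mem_comap,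
    Matrix.toLin'_apply, mulVec_single_add hθi hθf hG1 hℓf, div_mul_cancel₀ _ (he f), add_sub_cancel]
  have h := Submodule.smul_mem _ (constantCoeff (e ℓ)) hγA
  rwa [smul_add, smul_smul, mul_comm (constantCoeff (e ℓ)) γ] at h

/-- **THE TRANSLATION IS READ OFF THE KERNEL**: if the kernel of `A` meets the line `e_{πℓ} + K·e_{πf}` only in
`e_{πℓ} + γ·e_{πf}` (`huniq`; the light class, FILE 1), then EVERY `γ′` with `e_ℓ + γ′·e_f ∈ resVertex B` satisfies the 1-jet
relation `γ · e_ℓ(0) = ∂_ℓ G(0) + γ′ · e_f(0)` of `SwapTransport.unitFrame_step` (res-dim4-p-11 g3).  The point: `γ′` does not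
depend on WHICH relation `(θ, e, G, U, E)` is used. [OURS] [cite: CossartJannsenSaito2020, Thm. 3.14] [cite: Hauser2010, §§F–G] -/
theorem jet_relation_of_mem_resVertex (hθi : ∀ i, i ≠ f → θ (π i) = X i * e i)
    (hθf : θ (π f) = X f * e f + G) (he : ∀ i, constantCoeff (e i) ≠ 0) (hG0 : constantCoeff G = 0)
    (hG1 : coeff (Finsupp.single f 1) G = 0) (hU : constantCoeff U ≠ 0) (hE : E ∈ originIdeal K ^ M)
    (hrel : B.F = deletePthPowers p (U ^ p * aeval θ A.F) + E) (ho : ordZero A.F = o) (hpo : ¬ p ∣ o) (hoM : o < M)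
    (hrA : ∀ d ∈ A.F.support, A.r ≤ d) (hrf : A.r (π f) = 0) (hrB : B.r = A.r.mapDomain π.symm)
    {ℓ : Fin 4} (hℓf : ℓ ≠ f) {γ γ' : K}
    (huniq : ∀ γ₁ γ₂ : K, (Pi.single (π ℓ) 1 : Fin 4 → K) + γ₁ • (Pi.single (π f) 1 : Fin 4 → K) ∈ resVertex A →
      (Pi.single (π ℓ) 1 : Fin 4 → K) + γ₂ • (Pi.single (π f) 1 : Fin 4 → K) ∈ resVertex A → γ₁ = γ₂)
    (hγA : (Pi.single (π ℓ) 1 : Fin 4 → K) + γ • (Pi.single (π f) 1 : Fin 4 → K) ∈ resVertex A)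
    (hγ'B : (Pi.single ℓ 1 : Fin 4 → K) + γ' • (Pi.single f 1 : Fin 4 → K) ∈ resVertex B) :
    γ * constantCoeff (e ℓ) = coeff (Finsupp.single ℓ 1) G + γ' * constantCoeff (e f) := by
  rw [resVertex_eq_comap p hθi hθf he hG0 hG1 hU hE hrel ho hpo hoM hrA hrf hrB, Submodule.mem_comap,
    Matrix.toLin'_apply, mulVec_single_add hθi hθf hG1 hℓf] at hγ'B
  have h := Submodule.smul_mem _ (constantCoeff (e ℓ))⁻¹ hγ'B
  rw [smul_add, smul_smul, inv_mul_cancel₀ (he ℓ), one_smul, smul_smul] at h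
  have hγeq := huniq _ _ hγA h
  rw [hγeq, mul_comm, ← mul_assoc, mul_inv_cancel₀ (he ℓ), one_mul]

end Read

end LightRep

end ResCone

end Summit.ResolutionOfSingularities.ResolutionOfSingularities.Theorems.PIDim4

end
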